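import Summits.RiemannHypothesis.RiemannHypothesis.Theses.SpectralTrace
import Literature.NumberTheory.LFunctions.RiemannSiegel

/-!
# Line `poisson-density-newton-kantorovich` — checked skeleton for the crux `WindowTraceArch`
(stmt-RiemannHypothesis-11195, route SpectralTrace)

Crux (fixed, by name): `Summit.RiemannHypothesis.RiemannHypothesis.Theses.SpectralTrace.WindowTraceArch`
= some real family `γ` reproduces `W(g)` (`HasSum`) on every Weil test supported in
`[-log 2, log 2]`.

THE LINE. Seed = the mirrored θ-lattice of phase `c`, `θ(x_n^c) = π(n+1-c)` (`n ≥ 0`, `x ≥ 10`;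
`c = 3/2` is the França–LeClair lattice `14.52, 20.65, 25.49, …`). By Poisson summation along the
chirp, the `k = 0` (density) channel reproduces the archimedean distribution `(θ'/π)^∧` EXACTLY
(Dirac mass `-(log 4π+γ)δ₀` and the `Pf e^{|t|/2}/2sinh|t|` part included), every aliasing
harmonic is non-stationary on `|t| < 2θ'(x_0^c)` (`≥ 0.767 > log 2` on the phase range), so the
seed defect is a smooth even function `D_c` on the window (`stub_densityChannel`). The phase `c`
is the only continuous knob on the COUNT SCALAR `D_c(0) = 2c - 3` (square-summable moves never
change it, so an exact family has phase exactly `3/2`): it is the BORDER unknown. Correction =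
free finite head `x̄ : Fin M → ℝ` (numerically pinned to ζ's first ordinates to ~1e-3) ∪ displaced
tail `x_n^c + φ_n` (`n ≥ M`). The linearised bordered operator
`(φ, dc) ↦ -Σ 2φ_n t sin(x_n^c t) + dc·∂_c(tail)` has an EXACT bounded right inverse by Fourier
inversion on a separated sub-family of the tail (`stub_windowSynthesis`, quantitative: `ℓ²_k`
coefficients ≤ `K ‖ψ‖_{H^k}` on the window), so Newton–Kantorovich at the tail seed (abstract
engine `stub_radiiPolynomial`, assembly `stub_newtonKantorovich`) gives a positive CORRECTION
RADIUS: every configuration whose residual is removed, to first order, by a bordered tail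
correction of weighted size `≤ ρ` is exactly correctable. THE BET (`stub_certificate`, hardest):
for some finite head the certified residual's exact linear correction is smaller than that radius
(the radii-polynomial inequality `p(r) < 0`: validated block for the head ⊕ explicit analytic
constants for the tail).

Composition `WindowTraceArch_of` (the five stub statements ⟹ the crux BY NAME) is kernel-checked
with no `sorry`; `WindowTraceArch_proof` instantiates it with the registered (sorried) stubs.

Disproof.lean honoured: `windowTraceArch_false_without_isWeilTest` — every identity here is over
`IsWeilTest` tests (smoothness of `g` = decay of `ĝ` makes all `HasSum`s absolute: stubs A, B, D,
E); `infinite_of_windowTrace` / `not_separated_of_windowTrace` /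
`not_bounded_localCount_of_windowTrace` / `card_near_le_log_of_windowTrace` — the witness is
head ∪ full θ-tail (infinite, spacing → 0, `≍ log T` per unit cell); only the MOVED atoms form a
separated sub-family; `not_mem_range_of_windowTraceArch_witness` (forbidden zone
`K > 1 ⊇ [0,14.10] ∪ [15.15,20.55]`, floats) — the head is free and numerically sits at
`14.13, 21.02, 25.01, 30.42, …`; §3 (`hasSum_weilMellin_zeros`, RH ⇒ crux) is not used: the line is
ζ-free. No landed `Negative/*` lemma (FiniteSpectrum, WithoutIsWeilTest, ComplexSpectrum,
BoundedDensity, UnitMass, LocalWeylTools, LocalWeyl) is contradicted by any stub instance.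
-/

set_option linter.unusedVariables false
set_option linter.dupNamespace false

noncomputable section

open Complex Filter Set MeasureTheory
open scoped Real Topology ContDiff

namespace Summit.RiemannHypothesis.RiemannHypothesis.Cruxes.WindowTraceArch.PoissonDensityNewtonKantorovich

open Literature.NumberTheory.LFunctions
open Summit.RiemannHypothesis.RiemannHypothesis.Theses.SpectralTrace

/-! ## Vocabulary (definitions only, no `sorry`) -/

/-- Collar half-width `B = log 2 ≈ 0.6931` — the crux window itself (no prime power is seen:
`weilPrimeTerm g = 0` for `tsupport g ⊆ [-log 2, log 2]`, so `W = polar + arch` there; any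
`B > log 2` would put the prime-`2` spike `-(log 2/√2)(δ_{log 2} + δ_{-log 2})` inside the collar
and the defect would not be a function). `B < 3/4 < 2θ'(x_0^c)` (`≥ 0.767` for phases
`c < 13/8`): every aliasing harmonic of the seed is non-stationary on the closed collar. -/
def collar : ℝ := Real.log 2

/-- Phase window `J = [23/16, 25/16] ∋ 3/2` (the França–LeClair phase `c = 3/2` is where the count
scalar `D_c(0) = 2c - 3` vanishes). -/
def phaseWindow : Set ℝ := Icc (23 / 16) (25 / 16)

/-- First point `t ≥ 10` at which the Riemann–Siegel theta function reaches the level `a`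
(for `a > θ(10)` — and `θ(10) < -2` is in the tree, `riemannSiegelTheta_ten_lt` — this is THE
solution of `θ(t) = a` on `[10, ∞)`: `θ` is continuous, strictly increasing on `[7, ∞)` and
unbounded, cf. `Literature.Barriers.RiemannHypothesis.gramPt`). -/
def thetaLevel (a : ℝ) : ℝ := sInf {t : ℝ | 10 ≤ t ∧ a ≤ riemannSiegelTheta t}

/-- The θ-lattice of phase `c`: `θ(x_n^c) = π(n + 1 - c)`, `n ≥ 0` (for `c = 3/2`:
`θ(x_n) = π(n - 1/2)`, the França–LeClair points `14.52, 20.65, 25.49, 29.74, …`; spacing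
`π/θ'(x) ∼ 2π/log(x/2π) → 0`; for `c ∈ (11/8, 13/8)` all levels exceed `-2 > θ(10)`, `x_0^c ≥ 13.5`). -/
def thetaLattice (c : ℝ) (n : ℕ) : ℝ := thetaLevel (π * ((n : ℝ) + 1 - c))

/-- A configuration: a free finite HEAD `x̄ : Fin M → ℝ` replacing the first `M` lattice atoms,
and the TAIL `x_n^c + φ_n`, `n ≥ M` (values `φ n` for `n < M` are ignored). -/
def config (M : ℕ) (xbar : Fin M → ℝ) (c : ℝ) (φ : ℕ → ℝ) (n : ℕ) : ℝ :=
  if h : n < M then xbar ⟨n, h⟩ else thetaLattice c n + φ n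

/-- The mirrored (even) family `{y_n} ∪ {-y_n}` indexed by `ℕ ⊕ ℕ`. -/
def pmFamily (y : ℕ → ℝ) : ℕ ⊕ ℕ → ℝ := Sum.elim y fun n => -y n

/-- `ExactOn A y`: the mirrored family of `y` reproduces the Weil functional on every Weil test
supported in `[-A, A]` (the crux body for this family; `A = log 2` is the crux window). -/
def ExactOn (A : ℝ) (y : ℕ → ℝ) : Prop :=
  ∀ g : ℝ → ℂ, IsWeilTest g → tsupport g ⊆ Icc (-A) A →
    HasSum (fun i : ℕ ⊕ ℕ => weilMellin g (1 / 2 + (pmFamily y i : ℂ) * I)) (weilFunctional g)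

/-- `IsCollarDefect y E`: on collar (= window) tests the mirrored family of `y` reproduces
`W(g) + ∫ g·E`, i.e. `E` represents the DEFECT (family minus Weil distribution) on `(-B, B)`.
Only the values of `E` on the collar matter; `E` is determined there up to a.e.-equality. -/
def IsCollarDefect (y : ℕ → ℝ) (E : ℝ → ℝ) : Prop :=
  ∀ g : ℝ → ℂ, IsWeilTest g → tsupport g ⊆ Icc (-collar) collar →
    HasSum (fun i : ℕ ⊕ ℕ => weilMellin g (1 / 2 + (pmFamily y i : ℂ) * I))
      (weilFunctional g + ∫ t, g t * (E t : ℂ))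

/-- Pairing of the mirrored TAIL `{± x_n^c : n ≥ M}` of the θ-lattice of phase `c` with a test `g`
(a differentiable function of the phase; its `c`-derivative is the BORDER column of the
linearised system: a coherent, non-summable slide of the whole tail, the only continuous knob on
the count scalar). -/
def tailPairing (M : ℕ) (c : ℝ) (g : ℝ → ℂ) : ℂ :=
  ∑' n : ℕ, if n < M then (0 : ℂ) else
    (weilMellin g (1 / 2 + (thetaLattice c n : ℂ) * I) + weilMellin g (1 / 2 - (thetaLattice c n : ℂ) * I))

/-- `LinearisedSolve M c E φ⁰ dc⁰`: the tail displacement `φ⁰` (entries below `M` ignored) and the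
phase increment `dc⁰` solve the LINEARISED BORDERED equation at the tail seed EXACTLY on the
collar: `-Σ_{n ≥ M} 2 φ⁰_n t sin(x_n^c t) + dc⁰ · ∂_c(tail pairing) = -E` (pairing sense; the
first sum is the derivative of `y ↦ ĝ(½+iy) + ĝ(½-iy) = ∫ g(t) 2cos(yt) dt`; `Summable`-guarded).
At the seed the border equation at `t = 0` reads `2·dc⁰ = -(2c - 3)`, i.e. `c + dc⁰ = 3/2`. -/
def LinearisedSolve (M : ℕ) (c : ℝ) (E : ℝ → ℝ) (φ0 : ℕ → ℝ) (dc0 : ℝ) : Prop :=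
  ∀ g : ℝ → ℂ, IsWeilTest g → tsupport g ⊆ Icc (-collar) collar →
    (Summable fun n : ℕ => ((if n < M then 0 else φ0 n : ℝ) : ℂ) *
        ∫ t, g t * ((-(2 * t * Real.sin (thetaLattice c n * t)) : ℝ) : ℂ)) ∧
    (∑' n : ℕ, ((if n < M then 0 else φ0 n : ℝ) : ℂ) *
        ∫ t, g t * ((-(2 * t * Real.sin (thetaLattice c n * t)) : ℝ) : ℂ)) +
      (dc0 : ℂ) * deriv (fun c' : ℝ => tailPairing M c' g) c = -∫ t, g t * (E t : ℂ)

/-- `TailDispBound c k φ dc ρ`: weighted size of a bordered tail correction,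
`Σ_n φ_n² (1 + x_n^c)^{2k} (1 + log(1 + x_n^c)) + dc² ≤ ρ²` (`HasSum`-guarded, `ρ ≥ 0`). The
`ℓ²_k` scale is that of `stub_windowSynthesis`; the extra factor `1 + log(1 + x_n)` is the local
multiplicity of the FULL θ-tail per unit cell (`≍ θ'(x) ∼ ½ log(x/2π)`): by Montgomery–Vaughan's
Hilbert inequality with variable spacing `δ_n ≍ π/θ'(x_n)`,
`‖Σ a_n e^{i x_n t}‖²_{L²(-B,B)} ≤ Σ |a_n|² (2B + 3π/δ_n)`, so this is exactly the weight under
which a displacement of ALL tail atoms (not only of a separated sub-family) has a controlled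
effect on the collar defect. Monotone in `k` (`x_n ≥ 10`). -/
def TailDispBound (c : ℝ) (k : ℕ) (φ : ℕ → ℝ) (dc ρ : ℝ) : Prop :=
  0 ≤ ρ ∧ ∃ s : ℝ, HasSum (fun n : ℕ => φ n ^ 2 *
      ((1 + thetaLattice c n) ^ (2 * k) * (1 + Real.log (1 + thetaLattice c n)))) s ∧
    s + dc ^ 2 ≤ ρ ^ 2

/-- `LocalCorrection M c k ρ`: EVERY configuration (free head `x̄`, tail seed of phase `c`) whose
collar defect `E` is removed to first order by a bordered tail correction `(φ⁰, dc⁰)` of weighted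
size `≤ ρ` is EXACTLY correctable: some tail displacement `φ` and phase `c'` make
head ∪ tail reproduce `W` on the crux window. (Uniform in the head: the head is frozen and enters
only through its residual, which the linear correction cancels to first order.) -/
def LocalCorrection (M : ℕ) (c : ℝ) (k : ℕ) (ρ : ℝ) : Prop :=
  ∀ (xbar : Fin M → ℝ) (E : ℝ → ℝ) (φ0 : ℕ → ℝ) (dc0 : ℝ),
    IsCollarDefect (config M xbar c 0) E → LinearisedSolve M c E φ0 dc0 →
      TailDispBound c k φ0 dc0 ρ →
        ∃ (φ : ℕ → ℝ) (c' : ℝ), ExactOn (Real.log 2) (config M xbar c' φ)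

/-- The CORRECTION RADIUS of the tail of phase `c` above index `M` in the scale `k`: the supremum
of the `ρ ∈ [0, 1]` for which `LocalCorrection M c k ρ` holds (capped at `1` so that the `sSup` is
never the junk value of an unbounded set; non-decreasing in `k`). -/
def corrRadius (M : ℕ) (c : ℝ) (k : ℕ) : ℝ :=
  sSup {ρ : ℝ | 0 ≤ ρ ∧ ρ ≤ 1 ∧ LocalCorrection M c k ρ}

/-- Squared Sobolev `H^k` norm on the window: `Σ_{j ≤ k} ∫_{-B}^{B} |ψ^{(j)}|²`. -/
def sobolevSq (k : ℕ) (ψ : ℝ → ℝ) : ℝ :=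
  ∑ j ∈ Finset.range (k + 1), ∫ t in (-collar)..collar, (iteratedDeriv j ψ t) ^ 2

/-- Conclusion of the Newton–Kantorovich assembly (stub D): for every scale `k`, tail start `M`
and phase `c ∈ J` the correction radius is positive — some `ρ ∈ (0, 1]` has
`LocalCorrection M c k ρ` (it suffices to prove `k = 0`: `TailDispBound` is monotone in `k`). -/
def NKLocal : Prop :=
  ∀ (k M : ℕ) (c : ℝ), c ∈ phaseWindow → ∃ ρ : ℝ, 0 < ρ ∧ ρ ≤ 1 ∧ LocalCorrection M c k ρ

/-! ## The five stub STATEMENTS (`Stmt.stub_*`; the registered stubs below are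
`theorem stub_* : Stmt.stub_* := by sorry`, and `WindowTraceArch_of` takes exactly these five
propositions, by name, as hypotheses) -/

namespace Stmt

/-- STUB A statement — the Poisson DENSITY CHANNEL of the θ-lattice. There is a defect function
`D c t`, jointly `C^∞` in (phase, time) on `(11/8, 13/8) × (-3/4, 3/4)`, even in `t`, such that for
every phase `c ∈ J` the mirrored θ-lattice of phase `c` reproduces `W(g) + ∫ g·D_c` on every Weil
test supported in the window; and the count knob is live: `∂_c D_c(0) > 0` (bookkeeping value
`D_c(0) = 2c - 3`, slope `2`: one mirrored atom pair per unit of phase). Mechanism: Poisson /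
Euler–Maclaurin along the chirp `n = θ(x)/π + c - 1`; the `k = 0` term `∫_{x_0}^∞ 2cos(xt)θ'(x)/π dx`
is the archimedean distribution (`weilArchTerm g = ∫ ĝ(½+ix) θ'(x)/π dx` EXACTLY, digamma form,
`θ' = Re ψ(¼+ix/2)/2 - (log π)/2`) minus the entire function `∫_0^{x_0} 2cos(xt)θ'/π`; the polar
kernel `2cosh(t/2)` is entire; every aliasing harmonic `e^{i(±xt + 2k(θ(x)+π(c-1)))}`, `k ≠ 0`, is
non-stationary on `[x_0^c, ∞)` for `|t| < 2θ'(x_0^c)` (`2θ'(13.54) = 0.767 > 3/4` at `c = 13/8`),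
hence smooth after two integrations by parts; the boundary phases at `x_0^c` equal
`2k(θ(x_0^c) + π(c-1)) = 0`, so everything is smooth in `c` as well. Size L. -/
def stub_densityChannel : Prop :=
  ∃ D : ℝ → ℝ → ℝ,
    ContDiffOn ℝ ∞ (fun p : ℝ × ℝ => D p.1 p.2) (Ioo (11 / 8 : ℝ) (13 / 8) ×ˢ Ioo (-(3 / 4 : ℝ)) (3 / 4)) ∧
    (∀ c t, D c (-t) = D c t) ∧
    (∀ c ∈ phaseWindow, 0 < deriv (fun c' : ℝ => D c' 0) c) ∧
    ∀ c ∈ phaseWindow, IsCollarDefect (thetaLattice c) (D c)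

/-- STUB B statement — quantitative WINDOW SYNTHESIS by the tail (the density channel is an exact
right inverse, with decay). For every Sobolev index `k`, tail start `M` and phase `c ∈ J` there are
a constant `K` and a SEPARATED sub-family `S ⊆ {n ≥ M}` of the θ-lattice (the atom nearest to each
site `hm`, `m ≥ m₀`, of an auxiliary lattice `hℤ` with `h·log 2 < π`, available because the
θ-spacing → 0; `1/h > log 2/π` = the critical Beurling density of the window) such that every
smooth odd `ψ` is synthesised EXACTLY on the window, `2 Σ_{n ∈ S} φ_n sin(x_n^c t) = ψ(t)`,
`|t| ≤ log 2` (pairing sense), with `Σ φ_n² (1 + x_n^c)^{2k} ≤ K² ‖ψ‖²_{H^k(-log 2, log 2)}`.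
Mechanism (`k = 0`: Beurling–Seip frame bound for a separated sequence of density above critical;
general `k`): bounded extension `H^k(window) → H^k_per` of the period `2π/h ⊃` window killing the
`m₀` missing low sine modes (a finite, surjective moment problem on collar-supported functions),
Fourier inversion, then the almost-banded perturbation `sin(x_{n_m}t) - sin(hmt)`,
`x_{n_m} - hm → 0`, is a Neumann series on the high block in every `ℓ²_k` plus a finite-rank patch
(Young, *Nonharmonic Fourier series*, Thm 1.14, §4; Kadec; Avdonin). Size L. -/
def stub_windowSynthesis : Prop :=
  ∀ (k M : ℕ) (c : ℝ), c ∈ phaseWindow →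
    ∃ (K : ℝ) (S : Set ℕ), (∀ n ∈ S, M ≤ n) ∧
      (∃ δ : ℝ, 0 < δ ∧ ∀ n ∈ S, ∀ m ∈ S, n ≠ m → δ ≤ |thetaLattice c n - thetaLattice c m|) ∧
      ∀ ψ : ℝ → ℝ, ContDiff ℝ ∞ ψ → (∀ t, ψ (-t) = -ψ t) →
        ∃ φ : ℕ → ℝ, (∀ n, n ∉ S → φ n = 0) ∧
          (∃ s : ℝ, HasSum (fun n : ℕ => φ n ^ 2 * (1 + thetaLattice c n) ^ (2 * k)) s ∧
            s ≤ K ^ 2 * sobolevSq k ψ) ∧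
          ∀ g : ℝ → ℂ, IsWeilTest g → tsupport g ⊆ Icc (-collar) collar →
            HasSum (fun n : ℕ => (φ n : ℂ) * ∫ t, g t * ((2 * Real.sin (thetaLattice c n * t) : ℝ) : ℂ))
              (∫ t, g t * (ψ t : ℂ))

/-- STUB C statement — the RADII-POLYNOMIAL / Newton–Kantorovich fixed-point theorem
(Day–Lessard–Mischaikow, SIAM J. Numer. Anal. 45 (2007); van den Berg–Lessard, Notices AMS 62
(2015)), fixed-point form: a `C¹` self-map `T` of a real Banach space with `‖T x₀ - x₀‖ ≤ Y`,
`‖DT‖ ≤ Z < 1` on the closed ball `B(x₀, r)` and `Y + Z r ≤ r` has a fixed point in that ball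
(mean-value inequality on the convex ball, `Convex.norm_image_sub_le_of_norm_hasFDerivWithin_le`,
then Banach's contraction principle on the complete closed ball). The Newton form is
`T = id - A ∘ F`. Pure Mathlib-level functional analysis. Size M. -/
def stub_radiiPolynomial : Prop :=
  ∀ {X : Type} [NormedAddCommGroup X] [NormedSpace ℝ X] [CompleteSpace X]
    (T : X → X) (T' : X → X →L[ℝ] X) (x₀ : X) (r Y Z : ℝ),
    0 ≤ r → (∀ x ∈ Metric.closedBall x₀ r, HasFDerivAt T (T' x) x) →
      ‖T x₀ - x₀‖ ≤ Y → (∀ x ∈ Metric.closedBall x₀ r, ‖T' x‖ ≤ Z) → Z < 1 → Y + Z * r ≤ r →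
        ∃ x ∈ Metric.closedBall x₀ r, T x = x

/-- STUB D statement — NEWTON–KANTOROVICH ASSEMBLY at the tail seed: the density channel (A), the
window synthesis (B) and the fixed-point engine (C) give a positive correction radius at every
tail seed (`NKLocal`). Mechanism: Banach space `𝒴 = ℝ × L²_odd(window)`, `E ↔ (E(0), (E-E(0))/t)`
(the adapted splitting removes the derivative loss of dividing by `t`); bordered right inverse
`A = (A₁, A₂)`: `dc = E(0)/u(0)` with `u = ∂_c D_c` from (A) (`u(0) > 0`), then (B) with `k = 0` on
`ψ = -(E - dc·u)/t`, made LINEAR and bounded via the Hilbert-space projection onto `(ker)ᗮ`;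
`G(v) = defect(φ⁰ + A₁v, c + dc⁰ + A₂v) : 𝒴 → 𝒴` has `‖G(0)‖ ≲ ρ²` (quadratic Taylor remainder of
the exact linear solve; the `ℓ²`-with-log weight of `TailDispBound` controls displacements of the
full tail by the Montgomery–Vaughan Hilbert inequality), `‖DG(0) - I‖ ≲ ρ‖A‖`, `DG` Lipschitz
(Bessel bounds on the separated, slightly perturbed support of `A₁`; phase directions smooth by
(A)); then (C) with `r ≍ ρ` for `ρ ≤ ρ₀(M, c)`. The fixed point is an exact configuration
head ∪ (tail of phase `c'` displaced by `φ⁰ + A₁v`), and exactness in `𝒴` gives `ExactOn (log 2)`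
(absolute convergence from the decay of `ĝ`). Size L (paper) / XL (Lean). -/
def stub_newtonKantorovich : Prop :=
  stub_densityChannel → stub_windowSynthesis → stub_radiiPolynomial → NKLocal

/-- STUB E statement — THE CERTIFICATE (the bet of the line; the radii-polynomial inequality
`p(r) < 0` for the bordered head ⊕ tail system). For some scale `k`, head size `M`, phase `c ∈ J`
and explicit head `x̄` (numerically: ζ's first `M` ordinates to ~1e-3 — the under-capacity block
below `8π ≈ 25` is PINNED by the window data, mini_lsq / kit j010129; forbidden zone
`[0,14.10] ∪ [15.15,20.55]` respected; `|c - 3/2| ≤ ρ` is forced by the border equation), the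
window residual `E` of head ∪ tail-seed admits an exact linearised bordered correction
`(φ⁰, dc⁰)` whose weighted size `ρ` is below the correction radius. Proof shape: interval
arithmetic for the finite head sums and for `D_c` (explicit Poisson series of stub A, nearest
complex singularities at `|t| = 2θ'(x_M^c)`) on the window; an explicit constant `K(M)` in stub B
and explicit Lipschitz constants in stub D give a certified LOWER bound for `corrRadius M c k`;
B-type synthesis of `-E` with certified tail decay gives a certified UPPER bound for `ρ`. Known
risk (triage r1-3): seed-Jacobian condition numbers `4e3 → 9e10` for `(M, J) = (15,40) → (30,80)`
— the race of `K(M)` (grows with the number `≈ x_M^c/h` of missing low modes) against the residual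
floor (`6e-4 / 7e-5 / 8e-5` at `M = 10/20/30` in weak norm, mini_lsq). Size XL; hardest. -/
def stub_certificate : Prop :=
  ∃ (k M : ℕ) (c : ℝ) (xbar : Fin M → ℝ) (E : ℝ → ℝ) (φ0 : ℕ → ℝ) (dc0 ρ : ℝ),
    c ∈ phaseWindow ∧ IsCollarDefect (config M xbar c 0) E ∧ LinearisedSolve M c E φ0 dc0 ∧
      TailDispBound c k φ0 dc0 ρ ∧ ρ < corrRadius M c k

end Stmt

/-! ## Registered stubs -/

/-- **stub A — density channel** (Poisson summation on the chirped θ-lattice; smooth window defect,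
jointly smooth in the phase, live count knob). Size L. -/
theorem stub_densityChannel : Stmt.stub_densityChannel := by
  sorry

/-- **stub B — window synthesis** (exact `ℓ²_k → H^k` right inverse on a separated sub-family of
the tail above any index). Size L. -/
theorem stub_windowSynthesis : Stmt.stub_windowSynthesis := by
  sorry

/-- **stub C — radii-polynomial fixed-point theorem** (pure functional analysis; Mathlib-level).
Size M. -/
theorem stub_radiiPolynomial : Stmt.stub_radiiPolynomial := by
  sorry

/-- **stub D — Newton–Kantorovich assembly**: density channel + window synthesis + the fixed-point
engine give a positive correction radius at every tail seed. Size L. -/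
theorem stub_newtonKantorovich : Stmt.stub_newtonKantorovich := by
  sorry

/-- **stub E — the certificate** (validated numerics for the head ⊕ explicit analytic constants for
the tail): some head's residual has an exact linear correction below the correction radius.
Size XL; the hardest and the load-bearing stub. -/
theorem stub_certificate : Stmt.stub_certificate := by
  sorry

/-! ## Composition (kernel-checked, no `sorry`) -/

/-- `TailDispBound` is monotone in the radius. -/
theorem TailDispBound.mono {c : ℝ} {k : ℕ} {φ : ℕ → ℝ} {dc ρ ρ' : ℝ}
    (h : TailDispBound c k φ dc ρ) (hρ : ρ ≤ ρ') : TailDispBound c k φ dc ρ' := by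
  obtain ⟨hρ0, s, hs, hle⟩ := h
  refine ⟨hρ0.trans hρ, s, hs, hle.trans ?_⟩
  exact pow_le_pow_left₀ hρ0 hρ 2

/-- **Composition.** The five stub statements imply the crux `WindowTraceArch` BY NAME:
the certificate (E) supplies head, phase, residual and a linear correction of size
`ρ < corrRadius`; the Newton–Kantorovich assembly (D), fed with the density channel (A), window
synthesis (B) and the radii-polynomial engine (C), makes the set of admissible radii nonempty, so
some admissible `ρ' > ρ` exists (`exists_lt_of_lt_csSup`); `LocalCorrection` at `ρ'` returns an
exact configuration, whose mirrored family (index type `ℕ ⊕ ℕ`) is the witness. -/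
theorem WindowTraceArch_of (hA : Stmt.stub_densityChannel) (hB : Stmt.stub_windowSynthesis)
    (hC : Stmt.stub_radiiPolynomial) (hD : Stmt.stub_newtonKantorovich)
    (hE : Stmt.stub_certificate) : WindowTraceArch := by
  obtain ⟨k, M, c, xbar, E, φ0, dc0, ρ, hc, hdef, hlin, hbd, hlt⟩ := hE
  have hNK : NKLocal := hD hA hB hC
  obtain ⟨ρ₁, hρ₁pos, hρ₁le, hLC₁⟩ := hNK k M c hc
  have hne : ({ρ' : ℝ | 0 ≤ ρ' ∧ ρ' ≤ 1 ∧ LocalCorrection M c k ρ'} : Set ℝ).Nonempty :=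
    ⟨ρ₁, hρ₁pos.le, hρ₁le, hLC₁⟩
  obtain ⟨ρ', ⟨hρ'0, hρ'1, hLC⟩, hρρ'⟩ := exists_lt_of_lt_csSup hne hlt
  obtain ⟨φ, c', hex⟩ := hLC xbar E φ0 dc0 hdef hlin (hbd.mono hρρ'.le)
  -- the mirrored exact configuration is the witness family of the crux
  exact ⟨ℕ ⊕ ℕ, pmFamily (config M xbar c' φ), fun g hg hgs => hex g hg hgs⟩

/-- The skeleton instantiated with the registered (sorried) stubs: the crux follows from
`stub_densityChannel`, `stub_windowSynthesis`, `stub_radiiPolynomial`, `stub_newtonKantorovich`,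
`stub_certificate`. -/
theorem WindowTraceArch_proof : WindowTraceArch :=
  WindowTraceArch_of stub_densityChannel stub_windowSynthesis stub_radiiPolynomial
    stub_newtonKantorovich stub_certificate

end Summit.RiemannHypothesis.RiemannHypothesis.Cruxes.WindowTraceArch.PoissonDensityNewtonKantorovich

end
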